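import Literature.NumberTheory.Sieve.QuadraticRootsPrimeModuliDFIReduction
import HarnessLib

/-!
# Tóth 2000 (positive discriminant): the reduction to DFI's Theorem 5 and (34)–(35) (PROVED)

Topic `Literature/NumberTheory/Sieve`, companion of `PolynomialCongruencesPrimeModuli.lean` (the
named fact `Literature.NumberTheory.Sieve.toth2000_quadraticRoots_primeModuli`: for every
irreducible quadratic `f ∈ ℤ[X]` of positive discriminant and every `h ≠ 0`,
`∑_{p ≤ x} ρ_h(p) = o(π(x))`, `ρ_h(n) = ∑_{f(ν) ≡ 0 (mod n)} e(hν/n) = polyRootWeylSum f n h`;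
Á. Tóth, *Roots of quadratic congruences*, IMRN 2000:14, 719–739) and of the
Duke–Friedlander–Iwaniec files `QuadraticRootsPrimeModuliDFI*.lean`.

Tóth's proof has the architecture of Duke–Friedlander–Iwaniec's (Ann. of Math. 141 (1995), §7):
the sieve for complex sequences [cite: DukeFriedlanderIwaniec1995, Theorem 5 p. 437] (the named
fact `dukeFriedlanderIwaniec1995_theorem5`) turns the two hypotheses (34) (special bilinear forms
`R(D)`, level `D = x^{1/2−ε}`) and (35) (general bilinear forms `R(w, y)`) for the sequence
`c_n = ρ_h(n)` into `∑_{p ≤ x} ρ_h(p) ≪ ε π(x)`; the analytic heart of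
[cite: Toth2000, main theorem] is the supply of (34)–(35) for positive discriminant — a bound for
the Weyl linear forms `𝒲_h(x, N) = ∑_{x < n < 2x, N ∣ n} ρ_h(n) ≪_h (N²/x)^{1/4L} (x/N)^{1+1/L²}`
obtained from Poincaré series on Hecke congruence subgroups (via the correspondence between
roots of `f (mod n)` and binary quadratic forms), their spectral analysis and bounds for sums of
Kloosterman sums, restated as [cite: Ngo2024, §1 (1.3) and §3.2] — which is NOT vendored here
(the paper is not held; no new named fact is introduced in this file).  What this file PROVES is
the outer layer, for a general `f`:

* `exists_norm_polyRootWeylSum_le_of_irreducible` — for `f ∈ ℤ[X]` irreducible of degree `2`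
  (any sign of the discriminant), `|ρ_h(n)| ≤ ρ_f(n) ≤ C_f τ(n)` (Hooley's Lemma 4
  `ρ_f(n) ≤ C 2^{ω(n)}` and `2^{ω(n)} ≤ τ(n)`);
* `isLittleO_sum_primesLE_polyRootWeylSum_of_theorem5` — **Theorem 5 + (34) + (35) for `ρ_h` (all
  `0 < ε ≤ 1/12`) ⇒ `∑_{p ≤ P} ρ_h(p) = o(π(P))`** for ANY `f ∈ ℤ[X]` with `|ρ_h(n)| ≤ C τ(n)`
  and `h ≥ 1` (the argument of `DFI1995.isLittleO_sum_primesLE_of_theorem5`, which is the special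
  case `f = aX² + 2bX + c`, `ac > b²`; Theorem 5 is applied to `ρ_h / C`);
* `toth2000_quadraticRoots_primeModuli_of_theorem5` — **Tóth's theorem from Theorem 5 and the
  hypotheses (34), (35) for every irreducible quadratic of positive discriminant and every
  `h ≥ 1`** (`h < 0` by conjugation, `ρ_{−h} = conj ∘ ρ_h`).

So the trust base of a future discharge of `toth2000_quadraticRoots_primeModuli` along the printed
lines is: `dukeFriedlanderIwaniec1995_theorem5` and Tóth's linear/bilinear form bounds for
`Δ > 0` (to be vendored from the paper, with the deductions (34), (35) as in
`QuadraticRootsPrimeModuliDFILinear.lean` / `…DFIBilinear.lean`).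

## References

* Á. Tóth, *Roots of quadratic congruences*, Internat. Math. Res. Notices 2000, no. 14, 719–739.
  [cite: Toth2000, main theorem]
* W. Duke, J. B. Friedlander, H. Iwaniec, *Equidistribution of roots of a quadratic congruence to
  prime moduli*, Ann. of Math. (2) 141 (1995), 423–441, Theorem 5 p. 437 and §7 p. 438.
  [cite: DukeFriedlanderIwaniec1995, Theorem 5 and §7]
* H. T. Ngo, *On roots of quadratic congruences*, Bull. LMS 56 (2024) 2886–2910, §1
  (1.2)–(1.3) and §2 (Theorem 2.5: Kuznetsov formula, spectral large sieve, exceptional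
  eigenvalues). [cite: Ngo2024, §1]
-/

namespace Literature.NumberTheory.Sieve

open scoped BigOperators Polynomial
open Filter Asymptotics Finset Polynomial

/-! ### `|ρ_h(n)| ≤ C_f τ(n)` for an irreducible quadratic -/

/-- **`|ρ_h(n)| ≤ ρ_f(n) ≤ C_f τ(n)`** for `f ∈ ℤ[X]` irreducible of degree `2` (whatever the sign
of its discriminant): each term of `ρ_h(n)` is unimodular, `ρ_f(n) ≤ C_f 2^{ω(n)}` (Hooley's
Lemma 4, `exists_polyRootCountMod_le_mul_pow_card_primeFactors`) and `2^{ω(n)} ≤ τ(n)`.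
[folklore] -/
theorem exists_norm_polyRootWeylSum_le_of_irreducible {f : ℤ[X]} (hf : f.natDegree = 2)
    (hirr : Irreducible f) :
    ∃ Cρ : ℝ, 1 ≤ Cρ ∧ ∀ h : ℤ, ∀ n : ℕ, 1 ≤ n →
      ‖polyRootWeylSum f n h‖ ≤ Cρ * (Nat.divisors n).card := by
  obtain ⟨C₀, hC₀, hL4⟩ :=
    exists_polyRootCountMod_le_mul_pow_card_primeFactors hirr (by rw [hf]; norm_num)
  refine ⟨C₀, by exact_mod_cast hC₀, fun h n hn => ?_⟩
  have hn0 : n ≠ 0 := by omega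
  have h2 : polyRootCountMod ![f] n ≤ C₀ * (Nat.divisors n).card := by
    refine (hL4 n).trans ?_
    rw [hf]
    exact Nat.mul_le_mul_left _ (GoldbachSeries.two_pow_card_primeFactors_le_card_divisors hn0)
  calc ‖polyRootWeylSum f n h‖ ≤ (polyRootCountMod ![f] n : ℝ) := norm_polyRootWeylSum_le f n h
    _ ≤ ((C₀ * (Nat.divisors n).card : ℕ) : ℝ) := by exact_mod_cast h2
    _ = (C₀ : ℝ) * (Nat.divisors n).card := by push_cast; ring

/-! ### Theorem 5 + (34) + (35) ⇒ `∑_{p ≤ P} ρ_h(p) = o(π(P))`, for a general `f` -/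

/-- **DFI's §7 for a general polynomial.**  Let `f ∈ ℤ[X]` and `h ≥ 1` with
`|ρ_h(n)| ≤ C τ(n)` (`n ≥ 1`, some `C > 0`).  If the hypotheses (34) and (35) of DFI's Theorem 5
hold for the sequence `c_n = ρ_h(n)` for every `0 < ε ≤ 1/12` (`DFI1995.Hyp34 f h ε`,
`DFI1995.Hyp35 f h ε`), then Theorem 5 (`dukeFriedlanderIwaniec1995_theorem5`, applied to
`ρ_h / C`, everything being linear in `c`) gives `|∑_{p ≤ x} ρ_h(p)| ≤ C·C₅ ε π(x)` for
`x ≥ x₀(ε)`, i.e. `∑_{p ≤ P} ρ_h(p) = o(π(P))` on letting `ε → 0`.  This is the argument of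
`DFI1995.isLittleO_sum_primesLE_of_theorem5` (the case `f = aX² + 2bX + c`, `ac > b²`) verbatim;
nothing in it depends on the sign of the discriminant.
[cite: DukeFriedlanderIwaniec1995, §7 p. 438] -/
theorem isLittleO_sum_primesLE_polyRootWeylSum_of_theorem5
    (H5 : dukeFriedlanderIwaniec1995_theorem5) {f : ℤ[X]} {h : ℕ} {Cρ : ℝ} (hCρ0 : 0 < Cρ)
    (hρ : ∀ n : ℕ, 1 ≤ n → ‖polyRootWeylSum f n h‖ ≤ Cρ * (Nat.divisors n).card)
    (H34 : ∀ ε : ℝ, 0 < ε → ε ≤ 1 / 12 → DFI1995.Hyp34 f h ε)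
    (H35 : ∀ ε : ℝ, 0 < ε → ε ≤ 1 / 12 → DFI1995.Hyp35 f h ε) :
    (fun P : ℕ => ∑ p ∈ Nat.primesLE P, polyRootWeylSum f p h) =o[atTop]
      fun P : ℕ => (Nat.primeCounting P : ℝ) := by
  obtain ⟨C, HC⟩ := H5
  -- the scaled sequence
  set cs : ℕ → ℂ := fun n => (Cρ : ℂ)⁻¹ * DFI1995.rhoSeq f h n with hcs
  have hcs_le : ∀ n : ℕ, 1 ≤ n → ‖cs n‖ ≤ (Nat.divisors n).card := by
    intro n hn
    rw [hcs]
    simp only [DFI1995.rhoSeq_apply, norm_mul, norm_inv, Complex.norm_real, Real.norm_eq_abs,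
      abs_of_pos hCρ0]
    rw [inv_mul_le_iff₀ hCρ0]
    exact hρ n hn
  rw [Asymptotics.isLittleO_iff]
  intro δ hδ
  -- choose `ε`
  set C' : ℝ := max C 1 with hC'
  have hC'0 : 0 < C' := lt_max_of_lt_right one_pos
  set ε : ℝ := min (1 / 12) (δ / (Cρ * C')) with hε
  have hε0 : 0 < ε := lt_min (by norm_num) (div_pos hδ (mul_pos hCρ0 hC'0))
  have hε12 : ε ≤ 1 / 12 := min_le_left _ _
  -- the hypotheses of Theorem 5 for `cs`
  obtain ⟨x₁, A₁, h34⟩ := H34 ε hε0 hε12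
  obtain ⟨x₂, A₂, h35⟩ := H35 ε hε0 hε12
  have h34' : ∀ x : ℝ, max x₁ x₂ ≤ x → ∀ lam : ℕ → ℂ, (∀ d : ℕ, ‖lam d‖ ≤ 1) →
      ‖DFI1995.sieveR₁ cs lam x (x ^ (1 / 2 - ε))‖ ≤ Cρ⁻¹ * A₁ * x / Real.log x ^ 2 := by
    intro x hx lam hlam
    rw [hcs, DFI1995.sieveR₁_const_mul, norm_mul, norm_inv, Complex.norm_real,
      Real.norm_eq_abs, abs_of_pos hCρ0, mul_assoc, mul_div_assoc]
    exact mul_le_mul_of_nonneg_left (h34 x ((le_max_left _ _).trans hx) lam hlam)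
      (inv_nonneg.2 hCρ0.le)
  have h35' : ∀ x : ℝ, max x₁ x₂ ≤ x → ∀ α β : ℕ → ℂ,
      (∀ m : ℕ, ‖α m‖ ≤ ArithmeticFunction.cardDistinctFactors m) →
      (∀ n : ℕ, ‖β n‖ ≤ 1) → (∀ n : ℕ, ¬ n.Prime → β n = 0) →
      ‖DFI1995.sieveR₂ cs α β x (x ^ ((Real.log (Real.log x))⁻¹ ^ 3)) (x ^ (1 / 3 - ε))‖ ≤
        Cρ⁻¹ * A₂ * x / Real.log x ^ 10 := by
    intro x hx α β hα hβ hβp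
    rw [hcs, DFI1995.sieveR₂_const_mul, norm_mul, norm_inv, Complex.norm_real,
      Real.norm_eq_abs, abs_of_pos hCρ0, mul_assoc, mul_div_assoc]
    exact mul_le_mul_of_nonneg_left (h35 x ((le_max_right _ _).trans hx) α β hα hβ hβp)
      (inv_nonneg.2 hCρ0.le)
  obtain ⟨x₀, hx₀⟩ := HC ε hε0 hε12 cs hcs_le (max x₁ x₂) (Cρ⁻¹ * A₁) (Cρ⁻¹ * A₂) h34' h35'
  -- conclusion for `P ≥ x₀`
  filter_upwards [eventually_ge_atTop ⌈x₀⌉₊] with P hP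
  have hPx : x₀ ≤ (P : ℝ) := (Nat.le_ceil x₀).trans (by exact_mod_cast hP)
  have hmain := hx₀ (P : ℝ) hPx
  rw [Nat.floor_natCast] at hmain
  -- unscale
  have hsum : ∑ p ∈ Nat.primesLE P, cs p =
      (Cρ : ℂ)⁻¹ * ∑ p ∈ Nat.primesLE P, polyRootWeylSum f p h := by
    rw [hcs, Finset.mul_sum]
    rfl
  rw [hsum, norm_mul, norm_inv, Complex.norm_real, Real.norm_eq_abs, abs_of_pos hCρ0,
    inv_mul_le_iff₀ hCρ0] at hmain
  rw [Real.norm_natCast]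
  refine hmain.trans ?_
  have hπ : (0 : ℝ) ≤ Nat.primeCounting P := Nat.cast_nonneg _
  have hεle : ε ≤ δ / (Cρ * C') := min_le_right _ _
  have hCC' : C ≤ C' := le_max_left _ _
  calc Cρ * (C * ε * (Nat.primeCounting P : ℝ)) ≤ Cρ * (C' * ε * Nat.primeCounting P) := by
        gcongr
    _ ≤ Cρ * (C' * (δ / (Cρ * C')) * Nat.primeCounting P) := by gcongr
    _ = δ * Nat.primeCounting P := by field_simp

/-! ### Tóth's theorem from Theorem 5 and (34)–(35) for positive discriminant -/

/-- **Tóth's theorem from the architecture of its proof (PROVED reduction).**  If DFI's Theorem 5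
holds (`dukeFriedlanderIwaniec1995_theorem5`) and, for every irreducible `f ∈ ℤ[X]` of degree `2`
with positive discriminant, every `h ≥ 1` and every `0 < ε ≤ 1/12`, the sequence `c_n = ρ_h(n)`
satisfies the hypotheses (34) and (35) of that theorem (`DFI1995.Hyp34 f h ε`, `DFI1995.Hyp35 f h ε`
— in the paper these come from Tóth's linear and bilinear form bounds for `Δ > 0`, the analogues
of DFI's Propositions 1 and 2), then `toth2000_quadraticRoots_primeModuli` holds: for `h ≥ 1` by
`isLittleO_sum_primesLE_polyRootWeylSum_of_theorem5` with `|ρ_h(n)| ≤ C_f τ(n)`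
(`exists_norm_polyRootWeylSum_le_of_irreducible`), and for `h ≤ −1` by complex conjugation,
`ρ_{−h} = conj ∘ ρ_h` (`polyRootWeylSum_neg`).
[cite: Toth2000, main theorem; the deduction is DukeFriedlanderIwaniec1995 §7 with Theorem 5] -/
theorem toth2000_quadraticRoots_primeModuli_of_theorem5 (H5 : dukeFriedlanderIwaniec1995_theorem5)
    (H34 : ∀ f : ℤ[X], f.natDegree = 2 → Irreducible f →
      0 < discrim (f.coeff 2) (f.coeff 1) (f.coeff 0) → ∀ h : ℕ, 1 ≤ h →
      ∀ ε : ℝ, 0 < ε → ε ≤ 1 / 12 → DFI1995.Hyp34 f h ε)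
    (H35 : ∀ f : ℤ[X], f.natDegree = 2 → Irreducible f →
      0 < discrim (f.coeff 2) (f.coeff 1) (f.coeff 0) → ∀ h : ℕ, 1 ≤ h →
      ∀ ε : ℝ, 0 < ε → ε ≤ 1 / 12 → DFI1995.Hyp35 f h ε) :
    toth2000_quadraticRoots_primeModuli := by
  intro f hf hirr hΔ h hh
  obtain ⟨Cρ, hCρ, hρ⟩ := exists_norm_polyRootWeylSum_le_of_irreducible hf hirr
  have hCρ0 : (0 : ℝ) < Cρ := by linarith
  have key : ∀ m : ℕ, 1 ≤ m →
      (fun P : ℕ => ∑ p ∈ Nat.primesLE P, polyRootWeylSum f p (m : ℤ)) =o[atTop]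
        fun P : ℕ => (Nat.primeCounting P : ℝ) := fun m hm =>
    isLittleO_sum_primesLE_polyRootWeylSum_of_theorem5 H5 hCρ0 (hρ m) (H34 f hf hirr hΔ m hm)
      (H35 f hf hirr hΔ m hm)
  rcases lt_or_gt_of_ne hh with hneg | hpos
  · -- `h < 0`: conjugate
    obtain ⟨m, hm⟩ := Int.exists_eq_neg_ofNat (le_of_lt hneg)
    have hm1 : 1 ≤ m := by omega
    refine IsLittleO.of_norm_left ?_
    have hnorm : ∀ P : ℕ, ‖∑ p ∈ Nat.primesLE P, polyRootWeylSum f p h‖ =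
        ‖∑ p ∈ Nat.primesLE P, polyRootWeylSum f p (m : ℤ)‖ := by
      intro P
      rw [hm, show (-(m : ℤ) : ℤ) = -((m : ℕ) : ℤ) from rfl]
      simp_rw [polyRootWeylSum_neg]
      rw [← map_sum, RCLike.norm_conj]
    simp_rw [hnorm]
    exact (key m hm1).norm_left
  · obtain ⟨m, hm⟩ := Int.eq_ofNat_of_zero_le (le_of_lt hpos)
    have hm1 : 1 ≤ m := by omega
    rw [hm]
    exact key m hm1

end Literature.NumberTheory.Sieve
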